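import Literature.AlgebraicGeometry.Resolution.HenselRootsAmbient
import Mathlib.Algebra.CharP.Lemmas
import Mathlib.Data.Nat.Choose.Dvd
import HarnessLib

/-!
# `p`-th roots of `1`-units in henselian fields of mixed characteristic (Kuhlmann 2010, §2.2: Lemma 2.10, Cor. 2.11)

Topic: `Literature/AlgebraicGeometry/Resolution` (valued function fields). F.-V. Kuhlmann,
*Elimination of ramification I: The generalized stability theorem*, Trans. AMS 362 (2010)
5697–5727 = arXiv:1003.5678, §2.2 "`p`-th roots of `1`-units" (pp. 6–7 of the arXiv text):

> Throughout this paper, we will take `C` to be an element in the algebraic closure of `ℚ` such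
> that `C^{p-1} = -p` … Note that `C^p = -pC` and `vC = (1/(p-1)) vp > 0`. Consider the polynomial
> `X^p - (1+b)` with `b ∈ K`. Performing the transformation `X = CY + 1`, dividing by `C^p` and
> using that `C^p = -pC`, we obtain the polynomial `f(Y) = Y^p + g(Y) - Y - b/C^p` with
> `g(Y) = ∑_{i=2}^{p-1} binom(p,i) C^{i-p} Y^i` a polynomial with coefficients in `K(C)` of value `> 0`.
>
> **Lemma 2.10.** Let `(K,v)` be a henselian field containing all `p`-th roots of unity. Then
> `vb > (p/(p-1)) vp ⟹ 1 + b ∈ (K^×)^p` for all `b ∈ K`.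
>
> **Corollary 2.11.** Let `(K,v)` be a henselian field containing all `p`-th roots of unity.
> Take any `1`-units `1+b` and `1+c` in `K`. Then:
> a) `1 + b ∈ (1 + b + c)·(K^×)^p` if `vc > (p/(p-1)) vp`.
> b) `1 + b ∈ (1 + b + c)·(K^×)^p` if `1+c ∈ (K^×)^p` and `vbc > (p/(p-1)) vp`.
> c) `1 + c^p + pc ∈ (K^×)^p` if `vc^p > vp`.
> d) `1 + b - pc ∈ (1 + b + c^p)·(K^×)^p` if `vb ≥ (1/(p-1)) vp` and `vc^p > vp`.

These are the tools of the Kummer normal form of Prop. 4.6 (§4.1), i.e. of the value index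
`(vE:vF) = p` for Galois extensions of degree `p` of `K(x)^h` in mixed characteristic
(`Kuhlmann2010Prop46ValueIndex`, `NormalDegreePDefectlessVTGalois.lean`).

## Content (everything PROVED)

Ambient rendering (`Henselization.lean`, `HenselRootsAmbient.lean`): one valued field `(Ω, V)`,
a subfield `F ≤ Ω` with `(F, V ∩ F)` henselian (`IsHenselianField`), a prime `p` with `p ≠ 0`
in `Ω` and `v(p) < 1` (mixed characteristic `(0, p)`), and an element `C ∈ F` with
`C^{p-1} = -p`. Valuations are written multiplicatively (`V.valuation`), so that the level
condition "`vb > (p/(p-1)) vp = vC^p`" reads `V.valuation b < V.valuation C ^ p`.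

* `valuation_pow_pred_eq`, `valuation_C_pow`, `valuation_C_lt_one`, … — `v(C)^{p-1} = v(p)`,
  `v(C)^p = v(p)·v(C)`, `0 < v(C) < 1`.
* `exists_pow_eq_one_add_of_valuation_lt` — **Lemma 2.10**: `v(b) < v(C)^p ⇒ 1 + b = w^p`,
  `w ∈ F` (Hensel's Lemma, `exists_root_of_isHenselianField`, for
  `f(Y) = (Y + C⁻¹)^p − (1+b)C^{−p}`, the displayed polynomial, at the approximate root `0`:
  `f(0) = −b/C^p`, `f'(0) = p·C^{1−p} = −1`).
* `exists_eq_mul_pow_of_valuation_lt` — **Cor. 2.11 a)**;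
  `exists_eq_mul_pow_of_pow_eq_of_valuation_mul_lt` — **Cor. 2.11 b)**;
  `exists_pow_eq_one_add_pow_add_mul` — **Cor. 2.11 c)**;
  `exists_sub_mul_eq_mul_pow` — **Cor. 2.11 d)**; each following the printed proof.

## Sources

* F.-V. Kuhlmann, *Elimination of ramification I: The generalized stability theorem*, Trans.
  Amer. Math. Soc. 362 (2010) 5697–5727 = arXiv:1003.5678, §2.2 ((5)–(8), Lemmas 2.9–2.10,
  Cor. 2.11). [Kuhlmann2010]

## Rendering notes

* The source assumes "`K` contains all `p`-th roots of unity" and shows (Lemma 2.9) that for a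
  henselian field of characteristic `0` with residue characteristic `p` this is equivalent to
  `C ∈ K`; the proofs of Lemma 2.10 and Cor. 2.11 use only `C ∈ K`, which is the hypothesis
  taken here (in the application, `K(x)^h ⊇ K` with `K` algebraically closed, so `C ∈ K`).
  Lemma 2.9 itself is not needed and not proved here.
* "`a ∈ a'·(K^×)^p`" is rendered as `∃ w ∈ F, w ≠ 0 ∧ a = a'·w^p` (resp. `a' = a·w^p`).
-/

noncomputable section

open IsLocalRing

namespace Literature.AlgebraicGeometry.Resolution

universe u

variable {Ω : Type u} [Field Ω] (V : ValuationSubring Ω)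

/-! ### The constant `C` with `C^{p-1} = -p` -/

section Constant

variable {p : ℕ} (hp : p.Prime) {C : Ω} (hC : C ^ (p - 1) = -(p : Ω))
include hp hC

/-- `C ≠ 0` when `p ≠ 0` in `Ω` (`C^{p-1} = -p`). [cite: Kuhlmann2010, Section 2.2] -/
theorem C_ne_zero (hp0 : (p : Ω) ≠ 0) : C ≠ 0 := by
  rintro rfl
  rw [zero_pow (Nat.sub_ne_zero_of_lt hp.one_lt), eq_comm, neg_eq_zero] at hC
  exact hp0 hC

/-- `C^p = -p·C`. [cite: Kuhlmann2010, Section 2.2, (5)] -/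
theorem C_pow_eq : C ^ p = -(p : Ω) * C := by
  conv_lhs => rw [← Nat.sub_add_cancel hp.one_le, pow_succ, hC]

omit hp in
/-- `v(C)^{p-1} = v(p)` ("`vC = (1/(p-1)) vp`"). [cite: Kuhlmann2010, Section 2.2, (5)] -/
theorem valuation_pow_pred_eq : V.valuation C ^ (p - 1) = V.valuation (p : Ω) := by
  rw [← map_pow, hC, Valuation.map_neg]

/-- `v(C)^p = v(p)·v(C)` (`C^p = -pC`). [cite: Kuhlmann2010, Section 2.2, (5)] -/
theorem valuation_C_pow : V.valuation C ^ p = V.valuation (p : Ω) * V.valuation C := by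
  rw [← map_pow, C_pow_eq hp hC, map_mul, Valuation.map_neg]

omit hp in
/-- `v(C) < 1` when `v(p) < 1` ("`vC > 0`"). [cite: Kuhlmann2010, Section 2.2, (5)] -/
theorem valuation_C_lt_one (hvp : V.valuation (p : Ω) < 1) : V.valuation C < 1 := by
  by_contra h
  push Not at h
  have : (1 : V.ValueGroup) ≤ V.valuation C ^ (p - 1) := one_le_pow₀ h
  rw [valuation_pow_pred_eq V hC] at this
  exact not_lt.mpr this hvp

/-- `v(p) ≤ v(C)` (`vC = vp/(p-1) ≤ vp`). [cite: Kuhlmann2010, Section 2.2, (5)] -/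
theorem valuation_p_le_valuation_C (hvp : V.valuation (p : Ω) < 1) :
    V.valuation (p : Ω) ≤ V.valuation C := by
  rw [← valuation_pow_pred_eq V hC]
  exact pow_le_of_le_one zero_le (valuation_C_lt_one V hC hvp).le
    (Nat.sub_ne_zero_of_lt hp.one_lt)

/-- `v(C)^p < v(p)` when `p ≠ 0` in `Ω` and `v(p) < 1` (`vC^p = vp + vC > vp`).
[cite: Kuhlmann2010, Section 2.2, (5)] -/
theorem valuation_C_pow_lt_valuation_p (hp0 : (p : Ω) ≠ 0) (hvp : V.valuation (p : Ω) < 1) :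
    V.valuation C ^ p < V.valuation (p : Ω) := by
  rw [valuation_C_pow V hp hC]
  have hvp0 : 0 < V.valuation (p : Ω) := (Valuation.pos_iff _).mpr hp0
  calc V.valuation (p : Ω) * V.valuation C < V.valuation (p : Ω) * 1 :=
        mul_lt_mul_of_pos_left (valuation_C_lt_one V hC hvp) hvp0
    _ = V.valuation (p : Ω) := mul_one _

/-- `v(C)^p < 1`. [cite: Kuhlmann2010, Section 2.2, (5)] -/
theorem valuation_C_pow_lt_one (hvp : V.valuation (p : Ω) < 1) : V.valuation C ^ p < 1 :=
  pow_lt_one₀ zero_le (valuation_C_lt_one V hC hvp) hp.ne_zero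

end Constant

/-! ### Lemma 2.10 -/

section Lemma210

variable {F : Subfield Ω} (hF : IsHenselianField F (V.comap (algebraMap F Ω)))
  {p : ℕ} (hp : p.Prime) {C : Ω} (hCF : C ∈ F) (hC : C ^ (p - 1) = -(p : Ω))
  (hp0 : (p : Ω) ≠ 0) (hvp : V.valuation (p : Ω) < 1)
include hF hp hCF hC hp0 hvp

/-- **Kuhlmann 2010, Lemma 2.10** ("every 1-unit of level `> (p/(p-1)) vp` has a `p`-th root"):
for `(F, V ∩ F)` henselian containing `C` (`C^{p-1} = -p`), `p ≠ 0` in `Ω`, `v(p) < 1`, and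
`b ∈ F` with `v(b) < v(C)^p`, there is `w ∈ F` with `w^p = 1 + b`. PROVED as printed: the
polynomial `f(Y) = (Y + C⁻¹)^p − (1+b)C^{−p}` (the transform `X = CY + 1` of `X^p − (1+b)`,
divided by `C^p`) has coefficients in `V ∩ F`, reduction `Y^p − Y`, and the simple approximate
root `0`; Hensel's Lemma (`exists_root_of_isHenselianField`) gives a root `y`, and
`w = Cy + 1`. [cite: Kuhlmann2010, Lemma 2.10] -/
theorem exists_pow_eq_one_add_of_valuation_lt {b : Ω} (hbF : b ∈ F)
    (hb : V.valuation b < V.valuation C ^ p) : ∃ w ∈ F, w ^ p = 1 + b := by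
  classical
  have hC0 : C ≠ 0 := C_ne_zero hp hC hp0
  have hvC0 : V.valuation C ≠ 0 := (map_ne_zero _).mpr hC0
  have hvC1 : V.valuation C < 1 := valuation_C_lt_one V hC hvp
  have hvCp : V.valuation C ^ (p - 1) = V.valuation (p : Ω) := valuation_pow_pred_eq V hC
  set d : Ω := C⁻¹ with hd
  have hdF : d ∈ F := F.inv_mem hCF
  have hCd : C * d = 1 := mul_inv_cancel₀ hC0
  set f : Polynomial Ω :=
    (Polynomial.X + Polynomial.C d) ^ p - Polynomial.C ((1 + b) * d ^ p) with hf
  -- monic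
  have hmon : f.Monic := by
    refine ((Polynomial.monic_X_add_C d).pow p).sub_of_left (lt_of_le_of_lt Polynomial.degree_C_le ?_)
    rw [Polynomial.degree_pow, Polynomial.degree_X_add_C, nsmul_one, Nat.cast_pos]
    exact hp.pos
  -- coefficients
  have hcoefX : ∀ k, ((Polynomial.X + Polynomial.C d) ^ p).coeff k = d ^ (p - k) * (p.choose k : Ω) :=
    fun k => Polynomial.coeff_X_add_C_pow d p k
  have hnatV : ∀ n : ℕ, V.valuation (n : Ω) ≤ 1 := fun n => V.valuation_le_one_iff _ |>.mpr (natCast_mem V n)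
  have hcoef : ∀ k, f.coeff k ∈ V ∧ f.coeff k ∈ F := by
    intro k
    have hkF : f.coeff k ∈ F := by
      rw [hf, Polynomial.coeff_sub, hcoefX, Polynomial.coeff_C]
      refine sub_mem (mul_mem (pow_mem hdF _) (natCast_mem F _)) ?_
      split_ifs
      · exact mul_mem (add_mem F.one_mem hbF) (pow_mem hdF _)
      · exact F.zero_mem
    refine ⟨(V.valuation_le_one_iff _).mp ?_, hkF⟩
    rw [hf, Polynomial.coeff_sub, hcoefX, Polynomial.coeff_C]
    rcases Nat.lt_or_ge p k with hpk | hkp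
    · -- `k > p`: coefficient `0`
      rw [Nat.choose_eq_zero_of_lt hpk, Nat.cast_zero, mul_zero, if_neg (by omega), sub_zero,
        map_zero]
      exact zero_le_one
    rcases hkp.eq_or_lt with rfl | hkp'
    · -- `k = p`: coefficient `1`
      rw [Nat.sub_self, pow_zero, Nat.choose_self, Nat.cast_one, mul_one, if_neg hp.ne_zero,
        sub_zero, map_one]
    rcases Nat.eq_zero_or_pos k with rfl | hk0
    · -- `k = 0`: coefficient `-b d^p`
      rw [if_pos rfl, Nat.sub_zero, Nat.choose_zero_right, Nat.cast_one, mul_one,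
        show d ^ p - (1 + b) * d ^ p = -(b * d ^ p) by ring, Valuation.map_neg, map_mul, map_pow,
        hd, map_inv₀, inv_pow, mul_inv_le_iff₀ (pow_pos (zero_lt_iff.mpr hvC0) _), one_mul]
      exact hb.le
    · -- `0 < k < p`: `p ∣ binom(p,k)`, value `≤ v(p)/v(C)^{p-k} = v(C)^{k-1} ≤ 1`
      rw [if_neg hk0.ne', sub_zero, map_mul, map_pow, hd, map_inv₀, inv_pow]
      obtain ⟨m, hm⟩ := hp.dvd_choose_self hk0.ne' hkp'
      have h1 : V.valuation ((p.choose k : ℕ) : Ω) ≤ V.valuation C ^ (p - 1) := by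
        rw [hm, Nat.cast_mul, map_mul, hvCp]
        calc V.valuation (p : Ω) * V.valuation (m : Ω) ≤ V.valuation (p : Ω) * 1 :=
              mul_le_mul_right (hnatV m) _
          _ = V.valuation (p : Ω) := mul_one _
      have h2 : V.valuation C ^ (p - 1) = V.valuation C ^ (p - k) * V.valuation C ^ (k - 1) := by
        rw [← pow_add]
        congr 1
        omega
      rw [inv_mul_le_iff₀ (pow_pos (zero_lt_iff.mpr hvC0) _)]
      calc V.valuation ((p.choose k : ℕ) : Ω) ≤ V.valuation C ^ (p - 1) := h1
        _ = V.valuation C ^ (p - k) * V.valuation C ^ (k - 1) := h2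
        _ ≤ V.valuation C ^ (p - k) * 1 :=
            mul_le_mul_right (pow_le_one₀ zero_le hvC1.le) _
  -- the approximate root `0`
  have heval0 : f.eval 0 = -(b * d ^ p) := by
    rw [hf, Polynomial.eval_sub, Polynomial.eval_pow, Polynomial.eval_add, Polynomial.eval_X,
      Polynomial.eval_C, Polynomial.eval_C, zero_add]
    ring
  have ha : V.valuation (f.eval 0) < 1 := by
    rw [heval0, Valuation.map_neg, map_mul, map_pow, hd, map_inv₀, inv_pow,
      mul_inv_lt_iff₀ (pow_pos (zero_lt_iff.mpr hvC0) _), one_mul]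
    exact hb
  have hderiv : (Polynomial.derivative f).eval 0 = -1 := by
    rw [hf, Polynomial.derivative_sub, Polynomial.derivative_C, sub_zero,
      Polynomial.derivative_X_add_C_pow, Polynomial.eval_mul, Polynomial.eval_C,
      Polynomial.eval_pow, Polynomial.eval_add, Polynomial.eval_X, Polynomial.eval_C, zero_add,
      hd, inv_pow, hC, inv_neg, mul_neg, mul_inv_cancel₀ hp0]
  have ha' : V.valuation ((Polynomial.derivative f).eval 0) = 1 := by
    rw [hderiv, Valuation.map_neg, map_one]
  obtain ⟨y, hyF, -, hy, -⟩ :=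
    exists_root_of_isHenselianField V hF hmon hcoef F.zero_mem V.zero_mem ha ha'
  -- `w = C y + 1`
  refine ⟨C * (y + d), mul_mem hCF (add_mem hyF hdF), ?_⟩
  have hroot : (y + d) ^ p = (1 + b) * d ^ p := by
    have := hy
    rw [hf, Polynomial.eval_sub, Polynomial.eval_pow, Polynomial.eval_add, Polynomial.eval_X,
      Polynomial.eval_C, Polynomial.eval_C] at this
    exact sub_eq_zero.mp this
  rw [mul_pow, hroot, hd, inv_pow, mul_left_comm, mul_inv_cancel₀ (pow_ne_zero _ hC0), mul_one]

/-! ### Corollary 2.11 -/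

/-- **Kuhlmann 2010, Cor. 2.11 a)**: for `1`-units `1 + b` (`v(b) < 1`) and `c` with
`v(c) < v(C)^p` ("`vc > (p/(p-1)) vp`"), `1 + b + c ∈ (1 + b)·(F^×)^p`. PROVED as printed: the
quotient `(1+b+c)/(1+b) = 1 + c/(1+b)` has level `v(c)`, and Lemma 2.10 applies.
[cite: Kuhlmann2010, Cor. 2.11 a)] -/
theorem exists_eq_mul_pow_of_valuation_lt {b c : Ω} (hbF : b ∈ F) (hcF : c ∈ F)
    (hb : V.valuation b < 1) (hc : V.valuation c < V.valuation C ^ p) :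
    ∃ w ∈ F, w ≠ 0 ∧ 1 + b + c = (1 + b) * w ^ p := by
  have h1b : V.valuation (1 + b) = 1 := by
    rw [Valuation.map_add_eq_of_lt_left _ (by rwa [map_one]), map_one]
  have h1b0 : (1 + b : Ω) ≠ 0 := fun h => by rw [h, map_zero] at h1b; exact zero_ne_one h1b
  have hlev : V.valuation (c / (1 + b)) < V.valuation C ^ p := by
    rwa [map_div₀, h1b, div_one]
  have hlev1 : V.valuation (c / (1 + b)) < V.valuation (1 : Ω) := by
    rw [map_one]
    exact hlev.trans (valuation_C_pow_lt_one V hp hC hvp)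
  obtain ⟨w, hwF, hw⟩ := exists_pow_eq_one_add_of_valuation_lt V hF hp hCF hC hp0 hvp
    (div_mem hcF (add_mem F.one_mem hbF)) hlev
  refine ⟨w, hwF, ?_, ?_⟩
  · rintro rfl
    rw [zero_pow hp.ne_zero, eq_comm] at hw
    have : V.valuation (1 + c / (1 + b)) = 1 := by
      rw [Valuation.map_add_eq_of_lt_left _ hlev1, map_one]
    rw [hw, map_zero] at this
    exact zero_ne_one this
  · rw [hw, mul_add, mul_one, mul_div_cancel₀ _ h1b0]

/-- **Kuhlmann 2010, Cor. 2.11 b)**: for `1`-units `1 + b`, `1 + c` with `1 + c ∈ (F^×)^p` and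
`v(b)·v(c) < v(C)^p` ("`vbc > (p/(p-1)) vp`"), `1 + b + c ∈ (1 + b)·(F^×)^p`. PROVED as printed:
by a), `(1+b)(1+c) = 1 + (b + c) + bc ∈ (1 + b + c)·(F^×)^p`.
[cite: Kuhlmann2010, Cor. 2.11 b)] -/
theorem exists_eq_mul_pow_of_pow_eq_of_valuation_mul_lt {b c : Ω} (hbF : b ∈ F) (hcF : c ∈ F)
    (hb : V.valuation b < 1) (hc : V.valuation c < 1) (hcp : ∃ w₁ ∈ F, w₁ ^ p = 1 + c)
    (hbc : V.valuation b * V.valuation c < V.valuation C ^ p) :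
    ∃ w ∈ F, w ≠ 0 ∧ 1 + b + c = (1 + b) * w ^ p := by
  obtain ⟨w₁, hw₁F, hw₁⟩ := hcp
  have hbc' : V.valuation (b + c) < 1 := Valuation.map_add_lt _ hb hc
  have hbc'' : V.valuation (b * c) < V.valuation C ^ p := by rwa [map_mul]
  -- a): `1 + (b + c) + bc = (1 + b + c)·w^p`
  obtain ⟨w, hwF, hw0, hw⟩ := exists_eq_mul_pow_of_valuation_lt V hF hp hCF hC hp0 hvp
    (add_mem hbF hcF) (mul_mem hbF hcF) hbc' hbc''
  have h1c : V.valuation (1 + c) = 1 := by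
    rw [Valuation.map_add_eq_of_lt_left _ (by rwa [map_one]), map_one]
  have hw₁0 : w₁ ≠ 0 := by
    rintro rfl
    rw [zero_pow hp.ne_zero] at hw₁
    rw [← hw₁, map_zero] at h1c
    exact zero_ne_one h1c
  refine ⟨w₁ / w, div_mem hw₁F hwF, div_ne_zero hw₁0 hw0, ?_⟩
  -- `(1+b)(1+c) = (1+b+c) w^p` and `1 + c = w₁^p`
  have key : (1 + b) * w₁ ^ p = (1 + b + c) * w ^ p := by
    rw [hw₁, show (1 + b + c : Ω) = 1 + (b + c) by ring, ← hw]
    ring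
  rw [div_pow, mul_div_assoc', key, mul_div_assoc, div_self (pow_ne_zero _ hw0), mul_one]

/-- **Kuhlmann 2010, Cor. 2.11 c)**: if `v(c)^p < v(p)` ("`vc^p > vp`"), then
`1 + c^p + pc ∈ (F^×)^p`. PROVED as printed: `(1+c)^p = 1 + pc + c^p + ∑_{i=2}^{p-1} binom(p,i) cⁱ`
and the last sum has value `≤ v(p)·v(c)² < v(C)^p`, so a) applies (the binomial expansion is
Mathlib's `add_pow_prime_eq`: `(c+1)^p = c^p + 1 + p·c·∑_{0<k<p} c^{k-1}·(binom(p,k)/p)`, whose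
`k = 1` term is `pc`). [cite: Kuhlmann2010, Cor. 2.11 c)] -/
theorem exists_pow_eq_one_add_pow_add_mul {c : Ω} (hcF : c ∈ F)
    (hc : V.valuation c ^ p < V.valuation (p : Ω)) : ∃ w ∈ F, w ^ p = 1 + c ^ p + p * c := by
  classical
  have hC0 : C ≠ 0 := C_ne_zero hp hC hp0
  have hvC0 : V.valuation C ≠ 0 := (map_ne_zero _).mpr hC0
  have hvC1 : V.valuation C < 1 := valuation_C_lt_one V hC hvp
  have hvc1 : V.valuation c < 1 := by
    by_contra h
    push Not at h
    have : (1 : V.ValueGroup) ≤ V.valuation c ^ p := one_le_pow₀ h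
    exact not_lt.mpr (this.trans' hvp.le) hc |>.elim
  have hnatV : ∀ n : ℕ, V.valuation (n : Ω) ≤ 1 := fun n => V.valuation_le_one_iff _ |>.mpr (natCast_mem V n)
  -- the binomial expansion, with the `k = 1` term split off
  set S : Ω := ∑ k ∈ Finset.Ioo 1 p, c ^ (k - 1) * (1 : Ω) ^ (p - k - 1) * ((p.choose k / p : ℕ) : Ω)
    with hS
  have hexp : (c + 1) ^ p = c ^ p + 1 + p * c * (1 + S) := by
    rw [add_pow_prime_eq hp c 1, one_pow, mul_one]
    congr 1
    have hIoo : Finset.Ioo 0 p = insert 1 (Finset.Ioo 1 p) := by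
      rw [Finset.Ioo_insert_left hp.one_lt]
      rfl
    rw [hIoo, Finset.sum_insert (by simp), hS]
    congr 1
    rw [Nat.choose_one_right, Nat.div_self hp.pos]
    simp
  -- `v(S) ≤ v(c)`
  have hSval : V.valuation S ≤ V.valuation c := by
    refine Valuation.map_sum_le _ fun k hk => ?_
    rw [Finset.mem_Ioo] at hk
    rw [one_pow, mul_one, map_mul, map_pow]
    calc V.valuation c ^ (k - 1) * V.valuation ((p.choose k / p : ℕ) : Ω)
        ≤ V.valuation c ^ (k - 1) * 1 := mul_le_mul_right (hnatV _) _
      _ = V.valuation c ^ (k - 1) := mul_one _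
      _ ≤ V.valuation c ^ 1 := pow_le_pow_right_of_le_one' hvc1.le (by omega)
      _ = V.valuation c := pow_one _
  -- `s = p c S` has `v(s) ≤ v(p) v(c)^2 < v(C)^p`
  have hsF : (p : Ω) * c * S ∈ F := by
    refine mul_mem (mul_mem (natCast_mem F p) hcF) (sum_mem fun k _ => ?_)
    exact mul_mem (mul_mem (pow_mem hcF _) (pow_mem F.one_mem _)) (natCast_mem F _)
  have hc2 : V.valuation c * V.valuation c < V.valuation C := by
    -- from `v(c)^p < v(p) = v(C)^{p-1}`: `(v(c)^2)^p < v(C)^{2(p-1)} ≤ v(C)^p`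
    have h1 : (V.valuation c * V.valuation c) ^ p < V.valuation C ^ p := by
      calc (V.valuation c * V.valuation c) ^ p = V.valuation c ^ p * V.valuation c ^ p := mul_pow _ _ _
        _ < V.valuation (p : Ω) * V.valuation (p : Ω) := mul_lt_mul'' hc hc zero_le zero_le
        _ = V.valuation C ^ (p - 1 + (p - 1)) := by rw [pow_add, valuation_pow_pred_eq V hC]
        _ ≤ V.valuation C ^ p := pow_le_pow_right_of_le_one' hvC1.le (by have := hp.two_le; omega)
    exact lt_of_pow_lt_pow_left₀ p zero_le h1
  have hs : V.valuation ((p : Ω) * c * S) < V.valuation C ^ p := by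
    rw [map_mul, map_mul, valuation_C_pow V hp hC, mul_assoc]
    refine mul_lt_mul_of_pos_left ?_ ((Valuation.pos_iff _).mpr hp0)
    calc V.valuation c * V.valuation S ≤ V.valuation c * V.valuation c := mul_le_mul_right hSval _
      _ < V.valuation C := hc2
  -- a) with `b ← c^p + p c`, `c ← p c S`
  have hb : V.valuation (c ^ p + p * c) < 1 := by
    refine Valuation.map_add_lt _ ?_ ?_
    · rw [map_pow]; exact hc.trans hvp
    · rw [map_mul]
      calc V.valuation (p : Ω) * V.valuation c ≤ 1 * V.valuation c := mul_le_mul_left hvp.le _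
        _ < 1 := by rw [one_mul]; exact hvc1
  obtain ⟨w, hwF, hw0, hw⟩ := exists_eq_mul_pow_of_valuation_lt V hF hp hCF hC hp0 hvp
    (add_mem (pow_mem hcF p) (mul_mem (natCast_mem F p) hcF)) hsF hb hs
  -- `(1+c)^p = (1 + c^p + pc) w^p`
  have key : (c + 1) ^ p = (1 + (c ^ p + p * c)) * w ^ p := by
    rw [← hw, hexp]
    ring
  refine ⟨(c + 1) / w, div_mem (add_mem hcF F.one_mem) hwF, ?_⟩
  rw [div_pow, key, mul_div_assoc, div_self (pow_ne_zero _ hw0), mul_one, add_assoc]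

/-- **Kuhlmann 2010, Cor. 2.11 d)**: if `v(b) ≤ v(C)` ("`vb ≥ (1/(p-1)) vp`") and `v(c)^p < v(p)`
("`vc^p > vp`"), then `1 + b - pc ∈ (1 + b + c^p)·(F^×)^p`. PROVED as printed: by c),
`1 + (c^p + pc) ∈ (F^×)^p`, and b) applies to `b - pc` and `c^p + pc` since
`v(b - pc)·v(c^p + pc) < v(C)·v(p) = v(C)^p`. This is the step that replaces a monomial
`c^p = cᵢxⁱ` (`i ∈ pℤ`) by `-p·cᵢ^{1/p} x^{i/p}` in the Kummer normal form of Prop. 4.6.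
[cite: Kuhlmann2010, Cor. 2.11 d)] -/
theorem exists_sub_mul_eq_mul_pow {b c : Ω} (hbF : b ∈ F) (hcF : c ∈ F)
    (hb : V.valuation b ≤ V.valuation C) (hc : V.valuation c ^ p < V.valuation (p : Ω)) :
    ∃ w ∈ F, w ≠ 0 ∧ 1 + b - p * c = (1 + b + c ^ p) * w ^ p := by
  have hC0 : C ≠ 0 := C_ne_zero hp hC hp0
  have hvC0 : V.valuation C ≠ 0 := (map_ne_zero _).mpr hC0
  have hvC1 : V.valuation C < 1 := valuation_C_lt_one V hC hvp
  have hvc1 : V.valuation c < 1 := by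
    by_contra h
    push Not at h
    have : (1 : V.ValueGroup) ≤ V.valuation c ^ p := one_le_pow₀ h
    exact not_lt.mpr (this.trans' hvp.le) hc |>.elim
  have hpc : V.valuation ((p : Ω) * c) < V.valuation (p : Ω) := by
    rw [map_mul]
    calc V.valuation (p : Ω) * V.valuation c < V.valuation (p : Ω) * 1 :=
          mul_lt_mul_of_pos_left hvc1 ((Valuation.pos_iff _).mpr hp0)
      _ = V.valuation (p : Ω) := mul_one _
  -- hypotheses of b) for `b' = b - pc`, `c' = c^p + pc`
  have hb' : V.valuation (b - p * c) ≤ V.valuation C :=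
    Valuation.map_sub_le _ hb (hpc.le.trans (valuation_p_le_valuation_C V hp hC hvp))
  have hb'1 : V.valuation (b - p * c) < 1 := hb'.trans_lt hvC1
  have hc' : V.valuation (c ^ p + p * c) < V.valuation (p : Ω) :=
    Valuation.map_add_lt _ (by rwa [map_pow]) hpc
  have hc'1 : V.valuation (c ^ p + p * c) < 1 := hc'.trans hvp
  have hprod : V.valuation (b - p * c) * V.valuation (c ^ p + p * c) < V.valuation C ^ p := by
    rw [valuation_C_pow V hp hC, mul_comm (V.valuation (p : Ω))]
    exact mul_lt_mul' hb' hc' zero_le (zero_lt_iff.mpr hvC0)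
  obtain ⟨w₁, hw₁F, hw₁⟩ := exists_pow_eq_one_add_pow_add_mul V hF hp hCF hC hp0 hvp hcF hc
  obtain ⟨w, hwF, hw0, hw⟩ := exists_eq_mul_pow_of_pow_eq_of_valuation_mul_lt V hF hp hCF hC hp0
    hvp (sub_mem hbF (mul_mem (natCast_mem F p) hcF))
    (add_mem (pow_mem hcF p) (mul_mem (natCast_mem F p) hcF)) hb'1 hc'1
    ⟨w₁, hw₁F, by rw [hw₁, add_assoc]⟩ hprod
  -- `1 + b + c^p = (1 + b - pc) w^p`
  have key : 1 + b + c ^ p = (1 + (b - p * c)) * w ^ p := by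
    rw [← hw]
    ring
  refine ⟨w⁻¹, F.inv_mem hwF, inv_ne_zero hw0, ?_⟩
  rw [key, inv_pow, mul_assoc, mul_inv_cancel₀ (pow_ne_zero _ hw0), mul_one, add_sub_assoc]

end Lemma210

end Literature.AlgebraicGeometry.Resolution
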